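import Literature.Geometry.Lorentzian.KerrIngoingCoordRiemannFormula
import HarnessLib

/-!
# The Kerr curvature tensor in the rational principal frame (ingoing Kerr coordinates), II

Infrastructure (all results proved, no definitions) for the curvature invariants of the Kerr metric
(Kretschmann scalar `48 M² Re(r + iaμ)⁶/Σ⁶` and cubic Weyl invariant `48 M³ Re(r + iaμ)⁹/Σ⁹`; fact
stubs F3/F4 of crux `TameCensorship`, `KerrKretschmannScalar.lean`). In ingoing Kerr coordinates
`u = (t*, r, μ, φ)` (`KerrIngoingCoordMetric.lean`) the Kerr metric admits a PRINCIPAL FRAME WITH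
RATIONAL COMPONENTS

  `l = (r² + 2Mr + a²) ∂_{t*} + Δ ∂_r + 2a ∂_φ`  (outgoing principal null direction, `Δ = r² − 2Mr + a²`),
  `n = ∂_{t*} − ∂_r`                            (ingoing principal null direction, `−∂_r` at fixed `v = t* + r`),
  `e₃ = (1 − μ²) ∂_μ`,  `e₄ = a(1 − μ²) ∂_{t*} + ∂_φ`   (`√(1−μ²)·` the Kinnersley `m`, real and imaginary parts),

with Gram matrix `g(l,n) = −2Σ`, `g(e₃,e₃) = g(e₄,e₄) = Σ(1 − μ²)`, all other pairings `0`
(`Σ = r² + a²μ²`). Being algebraically special of Petrov type D with both `l`, `n` repeated principal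
null directions (Kerr 1963; Kinnersley 1969), the curvature tensor has in this frame only the
components generated by `Ψ₂ = −M/(r − i a μ)³`:
`Re Ψ₂ = −M(r³ − 3ra²μ²)/Σ³`, `Im Ψ₂ = −M(3r²aμ − a³μ³)/Σ³`. This file (continuing
`KerrPrincipalFrameCurvature.lean`) records the remaining lowered components `g(R(f_i,f_j) f_q, f_p)` for the pairs `(i<j) ≤ (p<q)` (the rest follow from the
symmetries `MetricCoord.IsMetricOn.apply_riemAt_swap/_pair_comm`, `MetricCoord.riemAt_swap`):
7 are nonzero, 14 vanish. Each is obtained from `Kerr.Ingoing.bilin_riemAt_eq_koszul` (the lowered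
curvature through the closed-form Koszul form) by `field_simp; ring` — closed forms generated by
computer algebra (exact rational arithmetic over `ℚ(r, μ, M, a)`) and checked here by Lean; nothing
is taken on trust. The frame vectors are written out explicitly (no definitions are introduced).

## References

* R. P. Kerr, Phys. Rev. Lett. 11 (1963) 237–238; R. P. Kerr, A. Schild (1965), §3. [KerrSchild1965]
* W. Kinnersley, *Type D vacuum metrics*, J. Math. Phys. 10 (1969) 1195.
* S. Chandrasekhar, *The mathematical theory of black holes* (1983), §58 (`Ψ₂ = −M/(r − ia cos θ)³`).
* B. O'Neill, *Semi-Riemannian geometry* (1983), Ch. 3, Lemma 3.38, Prop. 3.36. [ONeill1983]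
-/

noncomputable section

set_option maxSynthPendingDepth 3

open Set Function Module
open scoped ContDiff Topology
open Literature.Geometry.Lorentzian.MetricCoord

namespace Literature.Geometry.Lorentzian

namespace Kerr

namespace Ingoing

variable (M a : ℝ) {u : E4}

/-- Lowered principal-frame curvature component `g(R(l,e₄) e₄, l) = 0 (type D in the principal frame)` of the Kerr components in ingoing Kerr coordinates (`Ψ₂ = −M/(r − i a μ)³`, `Σ = r² + a²μ²`; `r = u 1`, `μ = u 2`). Generated by computer algebra (exact rational arithmetic) and checked here. [cite: KerrSchild1965, §3] -/
theorem pf_riem_l4_l4 (hu : u ∈ regularSet a) :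
    bilin M a u (riemAt (bilin M a) u (!₂[u 1 ^ 2 + 2 * M * u 1 + a ^ 2, u 1 ^ 2 - 2 * M * u 1 + a ^ 2, (0 : ℝ), 2 * a] : E4)
      (!₂[a * (1 - u 2 ^ 2), (0 : ℝ), 0, 1] : E4)
      (!₂[a * (1 - u 2 ^ 2), (0 : ℝ), 0, 1] : E4)) (!₂[u 1 ^ 2 + 2 * M * u 1 + a ^ 2, u 1 ^ 2 - 2 * M * u 1 + a ^ 2, (0 : ℝ), 2 * a] : E4) =
      0 := by
  have hS := hu.1
  have hP := hu.2
  rw [bilin_riemAt_eq_koszul M a hu]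
  simp only [ginvMat, Fin.sum_univ_four, Matrix.of_apply, Matrix.cons_val', Matrix.cons_val_zero,
    Matrix.cons_val_one, Matrix.cons_val, Matrix.empty_val', Matrix.cons_val_fin_one, Fin.isValue,
    zero_mul, add_zero, zero_add]
  simp only [koszulForm_bilin M a hu, dKoszulR, dKoszulM, bilinR_apply, bilinM_apply, bilinRR_apply,
    bilinRM_apply, bilinMM_apply, bv_apply, Fin.isValue, Fin.reduceEq, if_true, if_false,
    Matrix.cons_val_zero, Matrix.cons_val_one, Matrix.cons_val, 
    mul_one, one_mul, mul_zero, zero_mul, add_zero, zero_add, sub_zero, zero_sub]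
  simp only [h00, c33r, c33m, h00r, h00m, h03r, h03m, 
    c33rr, h00rr, h03rr, scalarH, scalarHr,
    scalarHm, scalarHrr]
  field_simp
  simp only [sigma, sinSq]
  ring

/-- Lowered principal-frame curvature component `g(R(l,e₄) e₃, n) = 2 Im Ψ₂ Σ² (1−μ²)` of the Kerr components in ingoing Kerr coordinates (`Ψ₂ = −M/(r − i a μ)³`, `Σ = r² + a²μ²`; `r = u 1`, `μ = u 2`). Generated by computer algebra (exact rational arithmetic) and checked here. [cite: KerrSchild1965, §3] -/
theorem pf_riem_l4_n3 (hu : u ∈ regularSet a) :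
    bilin M a u (riemAt (bilin M a) u (!₂[u 1 ^ 2 + 2 * M * u 1 + a ^ 2, u 1 ^ 2 - 2 * M * u 1 + a ^ 2, (0 : ℝ), 2 * a] : E4)
      (!₂[a * (1 - u 2 ^ 2), (0 : ℝ), 0, 1] : E4)
      (!₂[(0 : ℝ), 0, 1 - u 2 ^ 2, 0] : E4)) (!₂[(1 : ℝ), -1, 0, 0] : E4) =
      -(2 * M * (3 * u 1 ^ 2 * a * u 2 - a ^ 3 * u 2 ^ 3) * (1 - u 2 ^ 2)) / sigma a u := by
  have hS := hu.1
  have hP := hu.2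
  rw [bilin_riemAt_eq_koszul M a hu]
  simp only [ginvMat, Fin.sum_univ_four, Matrix.of_apply, Matrix.cons_val', Matrix.cons_val_zero,
    Matrix.cons_val_one, Matrix.cons_val, Matrix.empty_val', Matrix.cons_val_fin_one, Fin.isValue,
    zero_mul, add_zero, zero_add]
  simp only [koszulForm_bilin M a hu, dKoszulR, dKoszulM, bilinR_apply, bilinM_apply, bilinRR_apply,
    bilinRM_apply, bilinMM_apply, bv_apply, Fin.isValue, Fin.reduceEq, if_true, if_false,
    Matrix.cons_val_zero, Matrix.cons_val_one, Matrix.cons_val, 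
    mul_one, one_mul, mul_zero, zero_mul, add_zero, zero_add, sub_zero, zero_sub]
  simp only [h00, c22r, c33r, c33m, h00r, h00m, h03r, h03m, 
    h00rm, h03rm, scalarH, scalarHr,
    scalarHm, scalarHrm]
  field_simp
  simp only [sigma, sinSq]
  ring

/-- Lowered principal-frame curvature component `g(R(l,e₄) e₄, n) = −2 Re Ψ₂ Σ² (1−μ²)` of the Kerr components in ingoing Kerr coordinates (`Ψ₂ = −M/(r − i a μ)³`, `Σ = r² + a²μ²`; `r = u 1`, `μ = u 2`). Generated by computer algebra (exact rational arithmetic) and checked here. [cite: KerrSchild1965, §3] -/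
theorem pf_riem_l4_n4 (hu : u ∈ regularSet a) :
    bilin M a u (riemAt (bilin M a) u (!₂[u 1 ^ 2 + 2 * M * u 1 + a ^ 2, u 1 ^ 2 - 2 * M * u 1 + a ^ 2, (0 : ℝ), 2 * a] : E4)
      (!₂[a * (1 - u 2 ^ 2), (0 : ℝ), 0, 1] : E4)
      (!₂[a * (1 - u 2 ^ 2), (0 : ℝ), 0, 1] : E4)) (!₂[(1 : ℝ), -1, 0, 0] : E4) =
      2 * M * (u 1 ^ 3 - 3 * u 1 * a ^ 2 * u 2 ^ 2) * (1 - u 2 ^ 2) / sigma a u := by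
  have hS := hu.1
  have hP := hu.2
  rw [bilin_riemAt_eq_koszul M a hu]
  simp only [ginvMat, Fin.sum_univ_four, Matrix.of_apply, Matrix.cons_val', Matrix.cons_val_zero,
    Matrix.cons_val_one, Matrix.cons_val, Matrix.empty_val', Matrix.cons_val_fin_one, Fin.isValue,
    zero_mul, add_zero, zero_add]
  simp only [koszulForm_bilin M a hu, dKoszulR, dKoszulM, bilinR_apply, bilinM_apply, bilinRR_apply,
    bilinRM_apply, bilinMM_apply, bv_apply, Fin.isValue, Fin.reduceEq, if_true, if_false,
    Matrix.cons_val_zero, Matrix.cons_val_one, Matrix.cons_val, 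
    mul_one, one_mul, mul_zero, zero_mul, add_zero, zero_add, sub_zero, zero_sub]
  simp only [h00, c33r, c33m, h00r, h00m, h03r, h03m, 
    c33rr, h00rr, h03rr, scalarH, scalarHr,
    scalarHm, scalarHrr]
  field_simp
  simp only [sigma, sinSq]
  ring

/-- Lowered principal-frame curvature component `g(R(l,e₄) e₄, e₃) = 0 (type D in the principal frame)` of the Kerr components in ingoing Kerr coordinates (`Ψ₂ = −M/(r − i a μ)³`, `Σ = r² + a²μ²`; `r = u 1`, `μ = u 2`). Generated by computer algebra (exact rational arithmetic) and checked here. [cite: KerrSchild1965, §3] -/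
theorem pf_riem_l4_34 (hu : u ∈ regularSet a) :
    bilin M a u (riemAt (bilin M a) u (!₂[u 1 ^ 2 + 2 * M * u 1 + a ^ 2, u 1 ^ 2 - 2 * M * u 1 + a ^ 2, (0 : ℝ), 2 * a] : E4)
      (!₂[a * (1 - u 2 ^ 2), (0 : ℝ), 0, 1] : E4)
      (!₂[a * (1 - u 2 ^ 2), (0 : ℝ), 0, 1] : E4)) (!₂[(0 : ℝ), 0, 1 - u 2 ^ 2, 0] : E4) =
      0 := by
  have hS := hu.1
  have hP := hu.2
  rw [bilin_riemAt_eq_koszul M a hu]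
  simp only [ginvMat, Fin.sum_univ_four, Matrix.of_apply, Matrix.cons_val', Matrix.cons_val_zero,
    Matrix.cons_val_one, Matrix.cons_val, Matrix.empty_val', Matrix.cons_val_fin_one, Fin.isValue,
    zero_mul, add_zero, zero_add]
  simp only [koszulForm_bilin M a hu, dKoszulR, dKoszulM, bilinR_apply, bilinM_apply, bilinRR_apply,
    bilinRM_apply, bilinMM_apply, bv_apply, Fin.isValue, Fin.reduceEq, if_true, if_false,
    Matrix.cons_val_zero, Matrix.cons_val_one, Matrix.cons_val, 
    mul_one, one_mul, mul_zero, zero_mul, add_zero, zero_add, sub_zero, zero_sub]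
  simp only [h00, c22r, c33r, c33m, h00r, h00m, h03r, h03m, 
    c33rm, h00rm, h03rm, scalarH, scalarHr,
    scalarHm, scalarHrm]
  field_simp
  simp only [sigma, sinSq]
  ring

/-- Lowered principal-frame curvature component `g(R(n,e₃) e₃, n) = 0 (type D in the principal frame)` of the Kerr components in ingoing Kerr coordinates (`Ψ₂ = −M/(r − i a μ)³`, `Σ = r² + a²μ²`; `r = u 1`, `μ = u 2`). Generated by computer algebra (exact rational arithmetic) and checked here. [cite: KerrSchild1965, §3] -/
theorem pf_riem_n3_n3 (hu : u ∈ regularSet a) :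
    bilin M a u (riemAt (bilin M a) u (!₂[(1 : ℝ), -1, 0, 0] : E4)
      (!₂[(0 : ℝ), 0, 1 - u 2 ^ 2, 0] : E4)
      (!₂[(0 : ℝ), 0, 1 - u 2 ^ 2, 0] : E4)) (!₂[(1 : ℝ), -1, 0, 0] : E4) =
      0 := by
  have hS := hu.1
  have hP := hu.2
  rw [bilin_riemAt_eq_koszul M a hu]
  simp only [ginvMat, Fin.sum_univ_four, Matrix.of_apply, Matrix.cons_val', Matrix.cons_val_zero,
    Matrix.cons_val_one, Matrix.cons_val, Matrix.empty_val', Matrix.cons_val_fin_one, Fin.isValue,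
    zero_mul, add_zero, zero_add]
  simp only [koszulForm_bilin M a hu, dKoszulR, dKoszulM, bilinR_apply, bilinM_apply, bilinRR_apply,
    bilinRM_apply, bilinMM_apply, bv_apply, Fin.isValue, Fin.reduceEq, if_true, if_false,
    Matrix.cons_val_zero, Matrix.cons_val_one, Matrix.cons_val, 
    mul_one, one_mul, mul_zero, zero_mul, add_zero, zero_add, sub_zero, zero_sub]
  simp only [h00, c22r, c22m, h00r, h00m, h03r, h03m, c22rr, 
    h00mm, scalarH, scalarHr,
    scalarHm, scalarHmm]
  field_simp
  simp only [sigma, sinSq]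
  ring

/-- Lowered principal-frame curvature component `g(R(n,e₃) e₄, n) = 0 (type D in the principal frame)` of the Kerr components in ingoing Kerr coordinates (`Ψ₂ = −M/(r − i a μ)³`, `Σ = r² + a²μ²`; `r = u 1`, `μ = u 2`). Generated by computer algebra (exact rational arithmetic) and checked here. [cite: KerrSchild1965, §3] -/
theorem pf_riem_n3_n4 (hu : u ∈ regularSet a) :
    bilin M a u (riemAt (bilin M a) u (!₂[(1 : ℝ), -1, 0, 0] : E4)
      (!₂[(0 : ℝ), 0, 1 - u 2 ^ 2, 0] : E4)
      (!₂[a * (1 - u 2 ^ 2), (0 : ℝ), 0, 1] : E4)) (!₂[(1 : ℝ), -1, 0, 0] : E4) =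
      0 := by
  have hS := hu.1
  have hP := hu.2
  rw [bilin_riemAt_eq_koszul M a hu]
  simp only [ginvMat, Fin.sum_univ_four, Matrix.of_apply, Matrix.cons_val', Matrix.cons_val_zero,
    Matrix.cons_val_one, Matrix.cons_val, Matrix.empty_val', Matrix.cons_val_fin_one, Fin.isValue,
    zero_mul, add_zero, zero_add]
  simp only [koszulForm_bilin M a hu, dKoszulR, dKoszulM, bilinR_apply, bilinM_apply, bilinRR_apply,
    bilinRM_apply, bilinMM_apply, bv_apply, Fin.isValue, Fin.reduceEq, if_true, if_false,
    Matrix.cons_val_zero, Matrix.cons_val_one, Matrix.cons_val, 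
    mul_one, one_mul, mul_zero, zero_mul, add_zero, zero_add, sub_zero, zero_sub]
  simp only [h00, c22r, c33r, c33m, h00r, h00m, h03r, h03m, 
    h00rm, h03rm, scalarH, scalarHr,
    scalarHm, scalarHrm]
  field_simp
  simp only [sigma, sinSq]
  ring

/-- Lowered principal-frame curvature component `g(R(n,e₃) e₄, e₃) = 0 (type D in the principal frame)` of the Kerr components in ingoing Kerr coordinates (`Ψ₂ = −M/(r − i a μ)³`, `Σ = r² + a²μ²`; `r = u 1`, `μ = u 2`). Generated by computer algebra (exact rational arithmetic) and checked here. [cite: KerrSchild1965, §3] -/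
theorem pf_riem_n3_34 (hu : u ∈ regularSet a) :
    bilin M a u (riemAt (bilin M a) u (!₂[(1 : ℝ), -1, 0, 0] : E4)
      (!₂[(0 : ℝ), 0, 1 - u 2 ^ 2, 0] : E4)
      (!₂[a * (1 - u 2 ^ 2), (0 : ℝ), 0, 1] : E4)) (!₂[(0 : ℝ), 0, 1 - u 2 ^ 2, 0] : E4) =
      0 := by
  have hS := hu.1
  have hP := hu.2
  rw [bilin_riemAt_eq_koszul M a hu]
  simp only [ginvMat, Fin.sum_univ_four, Matrix.of_apply, Matrix.cons_val', Matrix.cons_val_zero,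
    Matrix.cons_val_one, Matrix.cons_val, Matrix.empty_val', Matrix.cons_val_fin_one, Fin.isValue,
    zero_mul, add_zero, zero_add]
  simp only [koszulForm_bilin M a hu, dKoszulR, dKoszulM, bilinR_apply, bilinM_apply, bilinRR_apply,
    bilinRM_apply, bilinMM_apply, bv_apply, Fin.isValue, Fin.reduceEq, if_true, if_false,
    Matrix.cons_val_zero, Matrix.cons_val_one, Matrix.cons_val, 
    mul_one, one_mul, mul_zero, zero_mul, add_zero, zero_add, sub_zero, zero_sub]
  simp only [h00, c22r, c22m, c33r, c33m, h00r, h00m, h03r, h03m, 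
    h00mm, h03mm, scalarH, scalarHr,
    scalarHm, scalarHmm]
  field_simp
  simp only [sigma, sinSq]
  ring

/-- Lowered principal-frame curvature component `g(R(n,e₄) e₄, n) = 0 (type D in the principal frame)` of the Kerr components in ingoing Kerr coordinates (`Ψ₂ = −M/(r − i a μ)³`, `Σ = r² + a²μ²`; `r = u 1`, `μ = u 2`). Generated by computer algebra (exact rational arithmetic) and checked here. [cite: KerrSchild1965, §3] -/
theorem pf_riem_n4_n4 (hu : u ∈ regularSet a) :
    bilin M a u (riemAt (bilin M a) u (!₂[(1 : ℝ), -1, 0, 0] : E4)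
      (!₂[a * (1 - u 2 ^ 2), (0 : ℝ), 0, 1] : E4)
      (!₂[a * (1 - u 2 ^ 2), (0 : ℝ), 0, 1] : E4)) (!₂[(1 : ℝ), -1, 0, 0] : E4) =
      0 := by
  have hS := hu.1
  have hP := hu.2
  rw [bilin_riemAt_eq_koszul M a hu]
  simp only [ginvMat, Fin.sum_univ_four, Matrix.of_apply, Matrix.cons_val', Matrix.cons_val_zero,
    Matrix.cons_val_one, Matrix.cons_val, Matrix.empty_val', Matrix.cons_val_fin_one, Fin.isValue,
    zero_mul, add_zero, zero_add]
  simp only [koszulForm_bilin M a hu, dKoszulR, dKoszulM, bilinR_apply, bilinM_apply, bilinRR_apply,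
    bilinRM_apply, bilinMM_apply, bv_apply, Fin.isValue, Fin.reduceEq, if_true, if_false,
    Matrix.cons_val_zero, Matrix.cons_val_one, Matrix.cons_val, 
    mul_one, one_mul, mul_zero, zero_mul, add_zero, zero_add, sub_zero, zero_sub]
  simp only [h00, c33r, c33m, h00r, h00m, h03r, h03m, 
    c33rr, h00rr, h03rr, scalarH, scalarHr,
    scalarHm, scalarHrr]
  field_simp
  simp only [sigma, sinSq]
  ring

/-- Lowered principal-frame curvature component `g(R(n,e₄) e₄, e₃) = 0 (type D in the principal frame)` of the Kerr components in ingoing Kerr coordinates (`Ψ₂ = −M/(r − i a μ)³`, `Σ = r² + a²μ²`; `r = u 1`, `μ = u 2`). Generated by computer algebra (exact rational arithmetic) and checked here. [cite: KerrSchild1965, §3] -/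
theorem pf_riem_n4_34 (hu : u ∈ regularSet a) :
    bilin M a u (riemAt (bilin M a) u (!₂[(1 : ℝ), -1, 0, 0] : E4)
      (!₂[a * (1 - u 2 ^ 2), (0 : ℝ), 0, 1] : E4)
      (!₂[a * (1 - u 2 ^ 2), (0 : ℝ), 0, 1] : E4)) (!₂[(0 : ℝ), 0, 1 - u 2 ^ 2, 0] : E4) =
      0 := by
  have hS := hu.1
  have hP := hu.2
  rw [bilin_riemAt_eq_koszul M a hu]
  simp only [ginvMat, Fin.sum_univ_four, Matrix.of_apply, Matrix.cons_val', Matrix.cons_val_zero,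
    Matrix.cons_val_one, Matrix.cons_val, Matrix.empty_val', Matrix.cons_val_fin_one, Fin.isValue,
    zero_mul, add_zero, zero_add]
  simp only [koszulForm_bilin M a hu, dKoszulR, dKoszulM, bilinR_apply, bilinM_apply, bilinRR_apply,
    bilinRM_apply, bilinMM_apply, bv_apply, Fin.isValue, Fin.reduceEq, if_true, if_false,
    Matrix.cons_val_zero, Matrix.cons_val_one, Matrix.cons_val, 
    mul_one, one_mul, mul_zero, zero_mul, add_zero, zero_add, sub_zero, zero_sub]
  simp only [h00, c22r, c33r, c33m, h00r, h00m, h03r, h03m, 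
    c33rm, h00rm, h03rm, scalarH, scalarHr,
    scalarHm, scalarHrm]
  field_simp
  simp only [sigma, sinSq]
  ring

/-- Lowered principal-frame curvature component `g(R(e₃,e₄) e₄, e₃) = −2 Re Ψ₂ Σ² (1−μ²)²` of the Kerr components in ingoing Kerr coordinates (`Ψ₂ = −M/(r − i a μ)³`, `Σ = r² + a²μ²`; `r = u 1`, `μ = u 2`). Generated by computer algebra (exact rational arithmetic) and checked here. [cite: KerrSchild1965, §3] -/
theorem pf_riem_34_34 (hu : u ∈ regularSet a) :
    bilin M a u (riemAt (bilin M a) u (!₂[(0 : ℝ), 0, 1 - u 2 ^ 2, 0] : E4)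
      (!₂[a * (1 - u 2 ^ 2), (0 : ℝ), 0, 1] : E4)
      (!₂[a * (1 - u 2 ^ 2), (0 : ℝ), 0, 1] : E4)) (!₂[(0 : ℝ), 0, 1 - u 2 ^ 2, 0] : E4) =
      2 * M * (u 1 ^ 3 - 3 * u 1 * a ^ 2 * u 2 ^ 2) * (1 - u 2 ^ 2) ^ 2 / sigma a u := by
  have hS := hu.1
  have hP := hu.2
  rw [bilin_riemAt_eq_koszul M a hu]
  simp only [ginvMat, Fin.sum_univ_four, Matrix.of_apply, Matrix.cons_val', Matrix.cons_val_zero,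
    Matrix.cons_val_one, Matrix.cons_val, Matrix.empty_val', Matrix.cons_val_fin_one, Fin.isValue,
    zero_mul, add_zero, zero_add]
  simp only [koszulForm_bilin M a hu, dKoszulR, dKoszulM, bilinR_apply, bilinM_apply, bilinRR_apply,
    bilinRM_apply, bilinMM_apply, bv_apply, Fin.isValue, Fin.reduceEq, if_true, if_false,
    Matrix.cons_val_zero, Matrix.cons_val_one, Matrix.cons_val, 
    mul_one, one_mul, mul_zero, zero_mul, add_zero, zero_add, sub_zero, zero_sub]
  simp only [h00, c22r, c22m, c33r, c33m, h00r, h00m, h03r, h03m, 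
    c33mm, h00mm, h03mm, scalarH, scalarHr,
    scalarHm, scalarHmm]
  field_simp
  simp only [sigma, sinSq]
  ring

end Ingoing

end Kerr

end Literature.Geometry.Lorentzian

end
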